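import Summits.ResolutionOfSingularities.ResolutionOfSingularities.Theorems.DescentDescentPerfectToAllResidualWitnessMacLaneExhaustion
import Summits.ResolutionOfSingularities.ResolutionOfSingularities.Theorems.DescentDescentPerfectToAllResidualWitnessMacLanePRank
import Mathlib.Algebra.MvPolynomial.Cardinal
import Mathlib.RingTheory.Localization.Cardinality
import HarnessLib

/-!
# `DescentPerfectToAll` (stmt-ResolutionOfSingularities-0549): Mac Lane's field is a COUNTABLE residual inhabitant
# of INFINITE `p`-rank (part 4: packaging)

Route `ResolutionOfSingularities/Descent`, crux `DescentPerfectToAll`. Helper (OURS; not a statement of any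
manuscript; `--supports` the crux, does not close it). Packages parts 1–3
(`DescentDescentPerfectToAllResidualWitnessMacLane{,Exhaustion,PRank}`): the residual of the crux
(`descentPerfectToAll_iff_residual`: resolution over COUNTABLE fields of characteristic `p` that are not
EFT-separably exhausted) contains a field — Mac Lane's `𝓛 = 𝔽_p(T, Y)` inside `Frac(𝔽_p[s₀, s₁, …])` — which is
countable AND of infinite `p`-rank (`exists_countable_field_infinite_pRank_not_exhaustedByEssFiniteType`), i.e. an
inhabitant to which neither the `p`-rank-defect criterion
`not_exhaustedByEssFiniteType_of_pRank_le` (for any `r`) nor the finite-transcendence-degree dichotomy of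
`DescentDescentPerfectToAllPerfectCoreResidual` speaks. Compare `exists_countable_field_not_exhaustedByEssFiniteType`
(`p`-rank `1`). Also (RUNG-B-LIT §11b (β)): `macLaneLevel_frobenius_rank_unbounded` — no Mac Lane-separable level of
`𝓛` containing `t₀, t₁` is `F`-finite. [cite: MacLane1939SteinitzTowers, §8] [cite: MacLane1939ModularFieldsI, §7 Example (1)]
-/

noncomputable section

set_option linter.dupNamespace false -- mandated namespace of this single-conjunct summit

open MvPolynomial Cardinal

namespace Summit.ResolutionOfSingularities.ResolutionOfSingularities.Theorems

variable (p : ℕ) [Fact p.Prime]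

/-- The rational function field `Frac(𝔽_p[s₀, s₁, …])` is countable (`#𝔽_p[s] ≤ ℵ₀` and a localisation is not
bigger than the ring). [folklore] -/
theorem countable_fractionRing_mvPolynomial_nat_zmod : Countable (FractionRing (MvPolynomial ℕ (ZMod p))) := by
  have h1 : #(MvPolynomial ℕ (ZMod p)) ≤ ℵ₀ := by
    refine MvPolynomial.cardinalMk_le_max.trans ?_
    simp
  have h2 : #(FractionRing (MvPolynomial ℕ (ZMod p))) ≤ #(MvPolynomial ℕ (ZMod p)) :=
    IsLocalization.cardinalMk_le (L := FractionRing (MvPolynomial ℕ (ZMod p))) (nonZeroDivisors (MvPolynomial ℕ (ZMod p)))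
  exact Cardinal.mk_le_aleph0_iff.mp (h2.trans h1)

/-- **A countable residual inhabitant of infinite `p`-rank.** For every prime `p` there is a COUNTABLE field `k` of
characteristic `p` (Mac Lane's `𝓛`) such that (i) for every `r`, `k` carries a `k^p`-linearly independent family with
more than `p^r` members, and (ii) `k` is NOT EFT-separably exhausted (verbatim residual shape of
`descentPerfectToAll_iff_residual`). [cite: MacLane1939SteinitzTowers, §8 Lemma 8.1, Lemma 8.5] -/
theorem exists_countable_field_infinite_pRank_not_exhaustedByEssFiniteType :
    ∃ (k : Type) (_ : Field k) (_ : CharP k p), Countable k ∧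
      (∀ r : ℕ, ¬ ∀ (n : ℕ) (v : Fin n → k), LinearIndependent (frobenius k p).fieldRange v → n ≤ p ^ r) ∧
      ¬ ∀ s : Finset k,
        ∃ (k₀ : Type) (_ : Field k₀) (_ : PerfectField k₀) (E : Subfield k) (_ : Algebra k₀ E),
          Algebra.EssFiniteType k₀ E ∧ (↑s : Set k) ⊆ E ∧
          ∀ u : Finset k, LinearIndepOn E _root_.id (↑u : Set k) →
            LinearIndepOn E (fun y : k => y ^ p) (↑u : Set k) := by
  obtain ⟨L, hL, hne⟩ := exists_macLaneField_not_exhaustedByEssFiniteType p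
  haveI : CharP (FractionRing (MvPolynomial ℕ (ZMod p))) p :=
    charP_of_injective_algebraMap (IsFractionRing.injective (MvPolynomial ℕ (ZMod p)) _) p
  haveI : Countable (FractionRing (MvPolynomial ℕ (ZMod p))) := countable_fractionRing_mvPolynomial_nat_zmod p
  exact ⟨L, inferInstance, L.subtype.charP Subtype.val_injective p, inferInstance,
    fun r => macLaneField_frobenius_rank_unbounded p L hL r, hne⟩

/-- **No Mac Lane-separable level below `𝓛` containing `t₀, t₁` is `F`-finite** (RUNG-B-LIT §11b (β), OURS): if `E ≤ 𝓛`
contains `t₀, t₁` and `𝓛/E` is separable in Mac Lane's sense, then `E` (viewed in `A`) contains every `y_n`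
(`mem_macLaneLevel_of_macLane`), hence carries `E^p`-linearly independent families with more than `p^r` members for
every `r` (`not_frobenius_rank_le_of_macLaneY_mem`): `[E : E^p] = ∞`. In particular no field finitely generated over a
perfect or an `F`-finite field can serve as such a level. [cite: MacLane1939SteinitzTowers, §8 Lemma 8.5, fn. 21] -/
theorem macLaneLevel_frobenius_rank_unbounded (L : Subfield (FractionRing (MvPolynomial ℕ (ZMod p))))
    (hL : L = Subfield.closure (algebraMap (MvPolynomial ℕ (ZMod p)) (FractionRing (MvPolynomial ℕ (ZMod p))) '' ({q | ∃ j : ℕ, q = X j ^ p} ∪ {q | ∃ k : ℕ, q = X k + X (k + 1) * X (k + 2) ^ p})))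
    (E : Subfield L)
    (hML : ∀ u : Finset L, LinearIndepOn E _root_.id (↑u : Set L) →
      LinearIndepOn E (fun x : L => x ^ p) (↑u : Set L))
    (h0 : algebraMap (MvPolynomial ℕ (ZMod p)) (FractionRing (MvPolynomial ℕ (ZMod p))) (X 0) ^ p ∈ E.map L.subtype)
    (h1 : algebraMap (MvPolynomial ℕ (ZMod p)) (FractionRing (MvPolynomial ℕ (ZMod p))) (X 1) ^ p ∈ E.map L.subtype) (r : ℕ) :
    ¬ ∀ (n : ℕ) (v : Fin n → E.map L.subtype),
      LinearIndependent (frobenius (E.map L.subtype) p).fieldRange v → n ≤ p ^ r :=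
  not_frobenius_rank_le_of_macLaneY_mem p (E.map L.subtype)
    (fun k => ⟨algebraMap (MvPolynomial ℕ (ZMod p)) (FractionRing (MvPolynomial ℕ (ZMod p))) (X k + X (k + 1) * X (k + 2) ^ p), (mem_macLaneLevel_of_macLane p L hL E hML h0 h1 k).2⟩)
    (fun _ => rfl) r

end Summit.ResolutionOfSingularities.ResolutionOfSingularities.Theorems

end
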